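import Summits.KontsevichZagierPeriods.KontsevichZagierPeriods.Theses.CobordismMove
import Literature.NumberTheory.Transcendental.KZLogCalculusProofs
import Literature.NumberTheory.Transcendental.KZUnfoldedStokesProofs
import Literature.NumberTheory.Transcendental.KZGroundingRelations

/-!
# `ZeroCombination` (stmt-KontsevichZagierPeriods-17773, route CobordismMove) — proof

A `ℤ`-COMBINATION OF INTEGRAL REPRESENTATIONS ON A COMMON DOMAIN WHOSE INTEGRANDS COMBINE TO ZERO
POINTWISE IS A RELATION of the fixed Kontsevich–Zagier calculus of moves (piece P3 of the typed
decomposition `CubeLastNewtonLeibniz → CubeCoordinateCycle → ZeroCombination → CubeStokes` of the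
route's crux `CubeStokes`, stmt-KontsevichZagierPeriods-5566; it is where the closedness
`Σ_k (−1)^k ∂_k A_k = 0` is consumed).

Proof (iterated rule (1b), integrand additivity): the scaled representations `S_i = [σ, c_i f_i]`
exist (`exists_zsmul_rep`); `[S_i] − c_i • [R_i] ∈ relations` by induction on `c_i`
(`zsmul_sub_mem_relations`: integrand additivity upwards, integrand additivity with `[σ, −f]` and
`[σ, −f] + [σ, f] ∈ relations` downwards); `[σ, Σ_i c_i f_i] − Σ_i [S_i] ∈ relations`
(`KZ.of_sub_sum_integrand_mem_relations`); and `[σ, Σ_i c_i f_i]` has integrand `0` on `σ`, so it is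
a relation (`KZ.of_mem_relations_of_eqOn_zero`). `N = 0` is the empty sum.

This is §1 of the crux strategist's complete sorry-free proof
`Summits/KontsevichZagierPeriods/KontsevichZagierPeriods/Cruxes/CubeStokes/CubeStokesProof.lean`
(seat planner-cstrat-stmt-KontsevichZagierPeriods-5566-r1-0, 2026-08-17), re-homed under `Theorems/`
by lead c10 of crux stmt-KontsevichZagierPeriods-9129 (banking): the helper lemmas verbatim, the
literal body of the item as `zeroCombination_holds`, and the closing theorem
`zeroCombination_proof : ZeroCombination`. No definitions are introduced.

References: M. Kontsevich, D. Zagier, *Periods* (2001), §1.2, rule (1); A. Huber, S. Müller-Stach,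
*Periods and Nori Motives* (2017), §13.1.
-/

noncomputable section

open MeasureTheory Set
open Literature.NumberTheory.Transcendental
open Literature.ModelTheory.ExponentialFields (IsSemialgebraic)

namespace Summit.KontsevichZagierPeriods.CobordismMove

open Summit.KontsevichZagierPeriods.KontsevichZagierPeriods.Theses.CobordismMove

namespace ZeroCombination

variable {n : ℕ}

/-- An honest representation with a prescribed `ℚ`-semialgebraic, absolutely integrable integrand
on a `ℚ`-semialgebraic domain exists (it is the structure itself). [folklore] -/
theorem exists_rep {σ : Set (Fin n → ℝ)} (hσ : IsSemialgebraic ℚ σ) {g : (Fin n → ℝ) → ℝ}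
    (hg : IsSemialgebraicFunOn ℚ σ g) (hint : IntegrableOn g σ) :
    ∃ s : KZ.IntegralRep n, s.domain = σ ∧ s.integrand = g :=
  ⟨⟨σ, g, hσ, hg, hint⟩, rfl, rfl⟩

/-- The integer multiple `[σ, c f]` of a representation `[σ, f]` exists as an honest representation.
[cite: KontsevichZagier2001, §1.1] -/
theorem exists_zsmul_rep (r : KZ.IntegralRep n) (c : ℤ) :
    ∃ s : KZ.IntegralRep n, s.domain = r.domain ∧ s.integrand = fun x => (c : ℝ) * r.integrand x := by
  refine exists_rep r.isSemialgebraic_domain ?_ (r.integrableOn.const_mul (c : ℝ))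
  have h := IsSemialgebraicFunOn.mul_holds (isSemialgebraicFunOn_ratCast r.isSemialgebraic_domain (c : ℚ))
    r.isSemialgebraicFunOn_integrand
  refine h.congr fun x _ => ?_
  simp

/-- **Integer multiples are derivable**: if `s = [σ, c f]` and `r = [σ, f]` then
`[s] − c • [r] ∈ KZ.relations` (induction on `c`: integrand additivity upwards, integrand
additivity with `[σ, −f]` and `[σ, −f] + [σ, f] ∈ relations` downwards).
[cite: KontsevichZagier2001, §1.2 rule (1)] -/
theorem zsmul_sub_mem_relations (r : KZ.IntegralRep n) :
    ∀ (c : ℤ) (s : KZ.IntegralRep n), s.domain = r.domain →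
      EqOn s.integrand (fun x => (c : ℝ) * r.integrand x) s.domain →
      KZ.of s - c • KZ.of r ∈ KZ.relations := by
  intro c
  induction c using Int.induction_on with
  | zero =>
    intro s hsd hsi
    rw [zero_smul, sub_zero]
    exact KZ.of_mem_relations_of_eqOn_zero s fun x hx => by simpa using hsi hx
  | succ m ih =>
    intro s' hs'd hs'i
    obtain ⟨s, hsd, hsi⟩ := exists_zsmul_rep r (m : ℤ)
    have h1 : KZ.of s - (m : ℤ) • KZ.of r ∈ KZ.relations := ih s hsd (by rw [hsi]; exact fun x _ => rfl)
    have h2 : KZ.of s' - KZ.of s - KZ.of r ∈ KZ.relations := by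
      refine KZ.integrandAddRel_subset_relations ⟨n, s', s, r, by rw [hsd, hs'd], hs'd.symm, ?_, rfl⟩
      intro x hx
      rw [hs'i hx, Pi.add_apply, hsi]
      push_cast
      ring
    have : KZ.of s' - ((m : ℤ) + 1) • KZ.of r = (KZ.of s' - KZ.of s - KZ.of r) + (KZ.of s - (m : ℤ) • KZ.of r) := by
      rw [add_smul, one_smul]
      abel
    rw [this]
    exact KZ.relations.add_mem h2 h1
  | pred m ih =>
    intro s' hs'd hs'i
    obtain ⟨s, hsd, hsi⟩ := exists_zsmul_rep r (-(m : ℤ))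
    have h1 : KZ.of s - (-(m : ℤ)) • KZ.of r ∈ KZ.relations := ih s hsd (by rw [hsi]; exact fun x _ => rfl)
    have h2 : KZ.of s' - KZ.of s - KZ.of r.neg ∈ KZ.relations := by
      refine KZ.integrandAddRel_subset_relations ⟨n, s', s, r.neg, by rw [hsd, hs'd], ?_, ?_, rfl⟩
      · rw [KZ.IntegralRep.domain_neg, hs'd]
      · intro x hx
        rw [hs'i hx, Pi.add_apply, hsi, KZ.IntegralRep.integrand_neg, Pi.neg_apply]
        push_cast
        ring
    have h3 : KZ.of r.neg + KZ.of r ∈ KZ.relations := by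
      have h := KZ.of_add_of_mem_relations_of_eqOn_neg (r := r) (r' := r.neg) (KZ.IntegralRep.domain_neg r)
        (fun x _ => by rw [KZ.IntegralRep.integrand_neg])
      rwa [add_comm] at h
    have : KZ.of s' - (-(m : ℤ) - 1) • KZ.of r =
        (KZ.of s' - KZ.of s - KZ.of r.neg) + (KZ.of s - (-(m : ℤ)) • KZ.of r) + (KZ.of r.neg + KZ.of r) := by
      rw [sub_smul, one_smul]
      abel
    rw [this]
    exact KZ.relations.add_mem (KZ.relations.add_mem h2 h1) h3

/-- **`ZeroCombination`, literal body** (stmt-KontsevichZagierPeriods-17773): a `ℤ`-combination of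
integral representations on a common domain `σ` whose integrands combine to `0` pointwise on `σ`
lies in `KZ.relations`. [cite: KontsevichZagier2001, §1.2 rule (1)] -/
theorem zeroCombination_holds :
    ∀ (n N : ℕ) (σ : Set (Fin n → ℝ)) (R : Fin N → Literature.NumberTheory.Transcendental.KZ.IntegralRep n)
      (c : Fin N → ℤ), (∀ i, (R i).domain = σ) → (∀ x ∈ σ, ∑ i, (c i : ℝ) * (R i).integrand x = 0) →
      (∑ i, c i • Literature.NumberTheory.Transcendental.KZ.of (R i)) ∈
        Literature.NumberTheory.Transcendental.KZ.relations := by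
  intro n N σ R c hdom hsum
  rcases Nat.eq_zero_or_pos N with rfl | hN
  · simp [KZ.relations.zero_mem]
  · have hσ : IsSemialgebraic ℚ σ := hdom ⟨0, hN⟩ ▸ (R ⟨0, hN⟩).isSemialgebraic_domain
    -- the scaled representations `S i = [σ, cᵢ fᵢ]`
    choose S hSd hSi using fun i => exists_zsmul_rep (R i) (c i)
    have h1 : ∀ i, KZ.of (S i) - c i • KZ.of (R i) ∈ KZ.relations := fun i =>
      zsmul_sub_mem_relations (R i) (c i) (S i) (hSd i) (by rw [hSi i]; exact fun x _ => rfl)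
    -- the honest representation `T = [σ, Σᵢ cᵢ fᵢ]`, whose integrand vanishes on `σ`
    have hTsa : IsSemialgebraicFunOn ℚ σ (fun x => ∑ i, (S i).integrand x) :=
      KZ.isSemialgebraicFunOn_finset_sum Finset.univ hσ fun i _ => by
        rw [← hdom i, ← hSd i]
        exact (S i).isSemialgebraicFunOn_integrand
    have hTint : IntegrableOn (fun x => ∑ i, (S i).integrand x) σ :=
      integrable_finsetSum Finset.univ fun i _ => by
        have h := (S i).integrableOn
        rwa [hSd i, hdom i] at h
    obtain ⟨T, hTd, hTi⟩ := exists_rep hσ hTsa hTint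
    have h2 : KZ.of T - ∑ i, KZ.of (S i) ∈ KZ.relations :=
      KZ.of_sub_sum_integrand_mem_relations Finset.univ S T (fun i _ => by rw [hSd i, hdom i, hTd])
        (by rw [hTi]; exact fun x _ => rfl)
    have h3 : KZ.of T ∈ KZ.relations := by
      refine KZ.of_mem_relations_of_eqOn_zero T fun x hx => ?_
      rw [hTd] at hx
      simp only [hTi, hSi, Pi.zero_apply]
      exact hsum x hx
    have key : ∑ i, c i • KZ.of (R i) =
        KZ.of T - (KZ.of T - ∑ i, KZ.of (S i)) - ∑ i, (KZ.of (S i) - c i • KZ.of (R i)) := by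
      rw [Finset.sum_sub_distrib]
      abel
    rw [key]
    exact KZ.relations.sub_mem (KZ.relations.sub_mem h3 h2) (KZ.relations.sum_mem fun i _ => h1 i)

/-- **Settles stmt-KontsevichZagierPeriods-17773 (`ZeroCombination`)**: the route declaration
`Summit.KontsevichZagierPeriods.KontsevichZagierPeriods.Theses.CobordismMove.ZeroCombination`,
concluded by name from its literal body `zeroCombination_holds`.
[cite: KontsevichZagier2001, §1.2 rule (1)] -/
theorem zeroCombination_proof : ZeroCombination :=
  zeroCombination_holds

end ZeroCombination

end Summit.KontsevichZagierPeriods.CobordismMove
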